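import Summits.QuantumFields.YangMills.Theorems.FluctuationComparisonRegPrIntLBackgroundFormKnit
import Summits.QuantumFields.YangMills.Theorems.FluctuationComparisonRegPrIntLBackgroundFormCauchyGlobal
import HarnessLib

/-!
# THE ANALYTIC EDITION OF THE BACKGROUND FORM: BOUNDED ANALYTIC TERMS ON A COLLAR OF THE BACKGROUND WINDOW ⇒ BGFORM∘ ⇒ S2β ∕ GRAD∘ (texts inline, def-free)

Cell `ym3-torus` (YM ladder rung R3 = continuum `SU(2)` Yang–Mills on the three-torus — a RUNG, NOT d = 4, NOT infinite volume, NOT a mass gap, NOT Clay).  Width seat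
`ym-ust-20520-w5` (gen 20); `--supports stmt-QuantumFields-20520 --as helper`, count-neutral, definition-free (row texts INLINE as binder ∕ conclusion types),
default heartbeats.

WHAT.  Ideator `ym-r3-idea-1` g24's LINE g24-4 «background_form» reduces the PATH-B organ S2β `FluctuationPartSmall` to ONE row BGFORM∘ `FluctuationBackgroundFormCan`
(lifted into `Theorems/` by LEAD w3-20520 g20: ✓`…BackgroundFormAlgebra`, ✓`…BackgroundFormKnit`).  Among the card's WHY-FAIL items, (c) reads «the Lipschitz∕C¹·¹
moduli of the terms in the BACKGROUND variables with `e^{−κ·d(X)}`-small pinned sums are (0.25) + analyticity (1.11)–(1.14) p.262 + Cauchy — a corollary».  THIS FILE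
types that corollary as a ROW-LEVEL knit, the g24-4 analogue of LEAD's ✓`…PolymerAnalyticKnit` (POLYᵃ∘ → POLYᵗ∘) for LINE g24-3:
* **BGFORMᵃ∘** (the ANALYTIC EDITION; hypothesis text of §1, = BGFORM∘'s text `Lines/background_form.lean` l.140–193 with FOUR changes and everything else
  VERBATIM): (1) one more uniform constant `Rₐ > 0` (the Cauchy radius; print: the per-bond imaginary-part bound `α₁` of (1.14), `O(1)` and independent of the
  window size `θ_J`); (2) the real moduli `T, ℓ, h` are REPLACED by analytic data per support `X`: a function `𝒯 X : (X → ℂ⁸) → ℂ` on the COMPLEXIFIED background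
  variables of `X`, a domain `Dom X`, an amplitude `Bx X ≥ 0` with the SAME pinned sums (`Σ_{X∋e} Bx X ≤ A`, `Σ_{X∋e,e′} Bx X ≤ Hc·e^{−2μd(e,e′)}` — (0.25)'s
  `E₀e^{−κd(X)}` resummed à la (1.26)); (3) the clauses (lip)∕(C11) are REPLACED by three analytic letters: `𝒯 X` complex-differentiable on `Dom X`, `‖𝒯 X‖ ≤ Bx X`
  on `Dom X`, and the COLLAR `ball ((M U)|_X ↪ ℂ⁸) (2Rₐ) ⊆ Dom X` for every window field `U` (sup norm on `X → ℂ⁸`; print: (1.11)–(1.14) is a uniform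
  `O(α₁)`-neighbourhood of the real small-field configurations); (4) the representation reads `log ρ U + β_K𝔄^reg U = c₀ + Σ_X Re 𝒯 X ((M U)|_X ↪ ℂ⁸)`.  The
  background map `M`, the pseudo-metric `d`, the anchor `π`, the response clauses (resp1)∕(resp2) and the super-polynomial moduli `σ, σ₂` are BGFORM∘'s, untouched
  (WHY-FAIL (f) — the product-kernel shape of the mixed response — stays a letter; its Cauchy SHAPE is ✓`…CauchyShape.norm_mixedDiff_le_of_differentiableOn_ball₂`).
* ★★★ `backgroundForm_of_analytic : ⟨BGFORMᵃ∘⟩ → ⟨BGFORM∘ VERBATIM⟩` with `T X u := Re 𝒯 X (u|_X ↪ ℂ⁸)`, `ℓ X := 2·Bx X∕Rₐ`, `h X := 16·Bx X∕Rₐ²`,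
  `A ↦ 2A∕Rₐ`, `Hc ↦ 16Hc∕Rₐ²` — (lip) and (C11) for ALL window pairs∕quadruples by this seat's GLOBAL COLLAR editions
  ✓`…CauchyGlobal.lip_of_local_analytic_collar` ∕ `c11_of_local_analytic_collar` (Schwarz lemma ×2 + boundedness; NO window-diameter letter, NO convexity of
  `Dom X`), the embedding `ℝ⁸ ↪ ℂ⁸` being norm-non-increasing coordinatewise (`Complex.norm_real`).
* ★★★ `fluctuationPartSmall_of_backgroundFormAnalytic : ⟨BGFORMᵃ∘⟩ → ⟨S2β registry :412 VERBATIM⟩` and ★★★ `oneBondOscillation_of_backgroundFormAnalytic :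
  ⟨BGFORMᵃ∘⟩ → ⟨GRAD∘ VERBATIM⟩` — composition with LEAD's ✓`…BackgroundFormKnit`.
NET FOR THE CARD: of LINE g24-4's WHY-FAIL list, (c) is now a kernel theorem; what stays inside BGFORMᵃ∘: (a) the last Mayer step (load-bearing), (b) the dictionary
`descend`∕`ℰp`, (d) torons, (f) the response's product kernel, (g) the gauge in which `M` is print's minimiser — and, above all, the EXISTENCE of the bounded analytic
terms with (0.25)-small pinned amplitudes on a uniform collar, which is Bałaban's theorem, not ours.

HONEST SCOPE.  Bookkeeping over ✓`…CauchyGlobal` ∕ ✓`…CauchyShape` ∕ ✓`…BackgroundFormKnit`; nothing of Bałaban's analyticity, bounds or representation is asserted or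
proved; BGFORMᵃ∘ ∕ BGFORM∘ ∕ S2β ∕ GRAD∘ ∕ the five registered ∘-stubs (v11.4 0∕5, №36 intact) ∕ `FluctuationComparisonRegPrIntL` (20520) NOT proved; no summit is
proved by a helper; rung R3 = SU(2) YM₃ on T³ — NOT d = 4, NOT infinite volume, NOT a mass gap, NOT Clay.  Sorry-free, axioms standard.

References: T. Bałaban, CMP **109** (1987) 249–301 [Balaban1987RG1] (Thm 1 p.259; (0.22)–(0.25) pp.256–257; (1.11)–(1.14) p.262); CMP **116** (1988) 1–22
[Balaban1988RG2Cluster] ((1.26) p.8); CMP **122** (1989) 355–392 [Balaban1989LargeFieldII] ((1.98)–(1.100) p.390); CMP **102** (1985) 277–309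
[Balaban1985Variational] (Prop. 9 p.309, (182)–(190) pp.307–308); CMP **102** (1985) 255–275 [Balaban1985UV3] (Thm 2 p.263, (41) p.266).
-/

set_option autoImplicit false

noncomputable section

namespace Summit.QuantumFields.YangMills.Theorems.FluctuationComparisonRegPrIntLBackgroundFormAnalyticKnit

open MeasureTheory Filter Topology Set
open scoped BigOperators
open Literature.MathematicalPhysics.QuantumFieldTheory.Balaban1983to89
open Literature.MathematicalPhysics.QuantumFieldTheory.Balaban1983to89.T3ContinuumYM3Torus
open Literature.MathematicalPhysics.QuantumFieldTheory.Balaban1983to89.T3NestedUnitLaws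
open Literature.MathematicalPhysics.QuantumFieldTheory.Balaban1983to89.T3UnitLawDensityEML
open Literature.MathematicalPhysics.QuantumFieldTheory.Balaban1983to89.T3UnitScaleTilt
open Literature.MathematicalPhysics.QuantumFieldTheory.Balaban1983to89.T3TiltDescent
open Literature.MathematicalPhysics.QuantumFieldTheory.Balaban1983to89.T3PrintedRegularMinimiser
open Literature.MathematicalPhysics.QuantumFieldTheory.Balaban1983to89.T3LevelShift
open Literature.MathematicalPhysics.QuantumFieldTheory.Balaban1983to89.Missing
open Literature.MathematicalPhysics.QuantumFieldTheory.Balaban1983to89.T4Continuum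
open Summit.QuantumFields.YangMills.Theorems.FluctuationComparisonRegPrIntLBackgroundFormCauchyShape
open Summit.QuantumFields.YangMills.Theorems.FluctuationComparisonRegPrIntLBackgroundFormCauchyGlobal
open Summit.QuantumFields.YangMills.Theorems.FluctuationComparisonRegPrIntLBackgroundFormKnit

/-! ## §1 BGFORMᵃ∘ → BGFORM∘ -/

/-- The coordinatewise embedding `ℝ⁸ ↪ ℂ⁸` does not increase the sup norm. [cite: Balaban1987RG1, (1.11)-(1.14) p.262] -/
theorem pi_norm_ofReal_le (x : Fin 8 → ℝ) : ‖(fun i => (x i : ℂ))‖ ≤ ‖x‖ :=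
  (pi_norm_le_iff_of_nonneg (norm_nonneg x)).mpr fun i => by rw [Complex.norm_real]; exact norm_le_pi_norm x i

/-- … hence differences of embedded coordinates are bounded by real differences. [cite: Balaban1987RG1, (1.11)-(1.14) p.262] -/
theorem pi_norm_ofReal_sub_le (x y : Fin 8 → ℝ) : ‖(fun i => (x i : ℂ)) - (fun i => (y i : ℂ))‖ ≤ ‖x - y‖ := by
  have : (fun i => (x i : ℂ)) - (fun i => (y i : ℂ)) = fun i => ((x - y) i : ℂ) := by
    funext i; simp [Complex.ofReal_sub]
  rw [this]; exact pi_norm_ofReal_le _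

/-- … and so are second differences. [cite: Balaban1987RG1, (1.11)-(1.14) p.262] -/
theorem pi_norm_ofReal_sub_sub_add_le (x y z w : Fin 8 → ℝ) :
    ‖(fun i => (x i : ℂ)) - (fun i => (y i : ℂ)) - (fun i => (z i : ℂ)) + (fun i => (w i : ℂ))‖ ≤ ‖x - y - z + w‖ := by
  have : (fun i => (x i : ℂ)) - (fun i => (y i : ℂ)) - (fun i => (z i : ℂ)) + (fun i => (w i : ℂ)) = fun i => ((x - y - z + w) i : ℂ) := by
    funext i; simp [Complex.ofReal_sub, Complex.ofReal_add]
  rw [this]; exact pi_norm_ofReal_le _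

/-- ★★★ **BGFORMᵃ∘ → BGFORM∘.**  Hypothesis = **BGFORMᵃ∘**, the ANALYTIC EDITION of LINE g24-4's row (BGFORM∘'s text with the real moduli `T, ℓ, h` and the clauses
(lip)∕(C11) replaced by, per support `X`, a function `𝒯 X` on the complexified background variables `X → ℂ⁸`, complex-differentiable and bounded by `Bx X` on a
domain `Dom X` containing the uniform `2Rₐ`-collar of the embedded background window, with BGFORM∘'s pinned sums on `Bx`; representation through `Re 𝒯 X`;
`M, d, π`, the response clauses and the super-polynomial moduli untouched); conclusion = BGFORM∘ `FluctuationBackgroundFormCan` VERBATIM (`Lines/background_form.lean`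
l.140–193 = the `hB` binder of ✓`…BackgroundFormKnit.fluctuationPartSmall_of_backgroundForm`) with `T X u := Re 𝒯 X (u|_X ↪ ℂ⁸)`, `ℓ X := 2·Bx X∕Rₐ`,
`h X := 16·Bx X∕Rₐ²`, `A ↦ 2A∕Rₐ`, `Hc ↦ 16Hc∕Rₐ²`; (lip)∕(C11) by ✓`…CauchyGlobal.lip_of_local_analytic_collar` ∕ `c11_of_local_analytic_collar`.
[cite: Balaban1987RG1, Thm 1 p.259, (0.22)-(0.25) pp.256-257 and (1.11)-(1.14) p.262; Balaban1988RG2Cluster, (1.26) p.8; Balaban1989LargeFieldII, (1.98)-(1.100) p.390; Balaban1985Variational, Prop. 9 p.309 and (182)-(190) pp.307-308] -/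
theorem backgroundForm_of_analytic
    (hA :
        ∀ (L : ℕ), ∃ pS : ℝ, ∀ (b₀ p₀ : ℝ), 0 < b₀ → pS ≤ p₀ → 0 < p₀ → ∃ ε₁ : ℝ, 0 < ε₁ ∧ ∀ (ε₀ : ℝ), 0 < ε₀ → ε₀ ≤ ε₁ →
          ∃ γ₁ : ℝ, 0 < γ₁ ∧ ∃ (κ μ C A Hc Rₐ : ℝ), 0 < κ ∧ 0 ≤ μ ∧ 0 ≤ A ∧ 0 ≤ Hc ∧ 0 < Rₐ ∧ ∀ (F : T3Family) (γ : ℝ), F.L = L → 0 < γ → γ ≤ γ₁ →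
            ∃ (σ σ₂ : ℕ → ℝ), (∀ J, 0 ≤ σ J) ∧ (∀ J, 0 ≤ σ₂ J) ∧
              (∀ a : ℕ, Tendsto (fun J : ℕ => ((J : ℝ) + 1) ^ a * σ J) atTop (𝓝 0)) ∧
              (∀ a : ℕ, Tendsto (fun J : ℕ => ((J : ℝ) + 1) ^ a * σ₂ J) atTop (𝓝 0)) ∧
              ∀ (ν : ℕ → (j : ℕ) → Measure (GaugeField (F.P j) 0 (Matrix.specialUnitaryGroup (Fin 2) ℂ))),
                (∀ K, ν K K = T4GenFunBounds.gibbsMeasure (F.P K) ((F.scheme ℰp γ).β K)) →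
                (∀ K j, j < K → ν K j = Measure.map (descend F ℰp j) (ν K (j + 1))) →
                ∀ (J K : ℕ) (hJK : J ≤ K) (ρ : GaugeField (F.P J) 0 (Matrix.specialUnitaryGroup (Fin 2) ℂ) → ℝ),
                  (∀ U, PlaqSmall (θBal F.L γ b₀ p₀ J) U → 0 < ρ U) →
                  ν K J = (fieldMeasure _ _ _).withDensity (fun U => ENNReal.ofReal (ρ U)) →
                  ContinuousOn ρ {U | PlaqSmall (θBal F.L γ b₀ p₀ J) U} →
                  ∃ (c₀ : ℝ) (π : PBond (F.P J) 0 → PBond (F.P K) 0) (d : PBond (F.P K) 0 → PBond (F.P K) 0 → ℝ)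
                    (M : GaugeField (F.P J) 0 (Matrix.specialUnitaryGroup (Fin 2) ℂ) → PBond (F.P K) 0 → (Fin 8 → ℝ))
                    (𝒯 : (X : Finset (PBond (F.P K) 0)) → ((↥X → (Fin 8 → ℂ)) → ℂ))
                    (Dom : (X : Finset (PBond (F.P K) 0)) → Set (↥X → (Fin 8 → ℂ)))
                    (Bx : Finset (PBond (F.P K) 0) → ℝ),
                    (∀ x y, 0 ≤ d x y) ∧ (∀ x y, d x y = d y x) ∧ (∀ x y z, d x z ≤ d x y + d y z) ∧
                    (∀ x, ∑ y, Real.exp (-(μ * d x y)) ≤ C) ∧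
                    (∀ b b' : PBond (F.P J) 0, κ * (b.src.tdist b'.src : ℝ) ≤ μ * d (π b) (π b')) ∧
                    (∀ X, 0 ≤ Bx X) ∧
                    (∀ e, ∑ X ∈ Finset.univ.filter (fun X => e ∈ X), Bx X ≤ A) ∧
                    (∀ e e', ∑ X ∈ Finset.univ.filter (fun X => e ∈ X ∧ e' ∈ X), Bx X ≤ Hc * Real.exp (-(2 * μ * d e e'))) ∧
                    (∀ X, DifferentiableOn ℂ (𝒯 X) (Dom X)) ∧
                    (∀ X, ∀ p ∈ Dom X, ‖𝒯 X p‖ ≤ Bx X) ∧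
                    (∀ (X : Finset (PBond (F.P K) 0)) (U : GaugeField (F.P J) 0 (Matrix.specialUnitaryGroup (Fin 2) ℂ)),
                        PlaqSmall (θBal F.L γ b₀ p₀ J) U →
                        Metric.ball (fun (e : ↥X) (i : Fin 8) => (M U e i : ℂ)) (2 * Rₐ) ⊆ Dom X) ∧
                    (∀ (b : PBond (F.P J) 0) (U V : GaugeField (F.P J) 0 (Matrix.specialUnitaryGroup (Fin 2) ℂ)),
                        PlaqSmall (θBal F.L γ b₀ p₀ J) U → PlaqSmall (θBal F.L γ b₀ p₀ J) V → (∀ e, e ≠ b → U e = V e) →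
                        ∀ e, ‖M U e - M V e‖ ≤ σ J * Real.exp (-(2 * μ * d (π b) e))) ∧
                    (∀ (b b' : PBond (F.P J) 0) (U V W Z : GaugeField (F.P J) 0 (Matrix.specialUnitaryGroup (Fin 2) ℂ)),
                        PlaqSmall (θBal F.L γ b₀ p₀ J) U → PlaqSmall (θBal F.L γ b₀ p₀ J) V →
                        PlaqSmall (θBal F.L γ b₀ p₀ J) W → PlaqSmall (θBal F.L γ b₀ p₀ J) Z →
                        (∀ e, e ≠ b → U e = V e) → (∀ e, e ≠ b' → U e = W e) → (∀ e, e ≠ b' → V e = Z e) → (∀ e, e ≠ b → W e = Z e) →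
                        ∀ e, ‖M U e - M W e - M V e + M Z e‖ ≤
                          σ₂ J * (Real.exp (-(2 * μ * d (π b) e)) * Real.exp (-(2 * μ * d e (π b'))))) ∧
                    (∀ U : GaugeField (F.P J) 0 (Matrix.specialUnitaryGroup (Fin 2) ℂ), PlaqSmall (θBal F.L γ b₀ p₀ J) U →
                        Real.log (ρ U) + (F.scheme ℰp γ).β K * minActionRegPr F J K hJK ε₀ U = c₀ + ∑ X, (𝒯 X (fun (e : ↥X) (i : Fin 8) => (M U e i : ℂ))).re)) :
      ∀ (L : ℕ), ∃ pS : ℝ, ∀ (b₀ p₀ : ℝ), 0 < b₀ → pS ≤ p₀ → 0 < p₀ → ∃ ε₁ : ℝ, 0 < ε₁ ∧ ∀ (ε₀ : ℝ), 0 < ε₀ → ε₀ ≤ ε₁ →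
        ∃ γ₁ : ℝ, 0 < γ₁ ∧ ∃ (κ μ C A Hc : ℝ), 0 < κ ∧ 0 ≤ μ ∧ 0 ≤ A ∧ 0 ≤ Hc ∧ ∀ (F : T3Family) (γ : ℝ), F.L = L → 0 < γ → γ ≤ γ₁ →
          ∃ (σ σ₂ : ℕ → ℝ), (∀ J, 0 ≤ σ J) ∧ (∀ J, 0 ≤ σ₂ J) ∧
            (∀ a : ℕ, Tendsto (fun J : ℕ => ((J : ℝ) + 1) ^ a * σ J) atTop (𝓝 0)) ∧
            (∀ a : ℕ, Tendsto (fun J : ℕ => ((J : ℝ) + 1) ^ a * σ₂ J) atTop (𝓝 0)) ∧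
            ∀ (ν : ℕ → (j : ℕ) → Measure (GaugeField (F.P j) 0 (Matrix.specialUnitaryGroup (Fin 2) ℂ))),
              (∀ K, ν K K = T4GenFunBounds.gibbsMeasure (F.P K) ((F.scheme ℰp γ).β K)) →
              (∀ K j, j < K → ν K j = Measure.map (descend F ℰp j) (ν K (j + 1))) →
              ∀ (J K : ℕ) (hJK : J ≤ K) (ρ : GaugeField (F.P J) 0 (Matrix.specialUnitaryGroup (Fin 2) ℂ) → ℝ),
                (∀ U, PlaqSmall (θBal F.L γ b₀ p₀ J) U → 0 < ρ U) →
                ν K J = (fieldMeasure _ _ _).withDensity (fun U => ENNReal.ofReal (ρ U)) →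
                ContinuousOn ρ {U | PlaqSmall (θBal F.L γ b₀ p₀ J) U} →
                ∃ (c₀ : ℝ) (π : PBond (F.P J) 0 → PBond (F.P K) 0) (d : PBond (F.P K) 0 → PBond (F.P K) 0 → ℝ)
                  (M : GaugeField (F.P J) 0 (Matrix.specialUnitaryGroup (Fin 2) ℂ) → PBond (F.P K) 0 → (Fin 8 → ℝ))
                  (T : Finset (PBond (F.P K) 0) → (PBond (F.P K) 0 → (Fin 8 → ℝ)) → ℝ)
                  (ℓ h : Finset (PBond (F.P K) 0) → ℝ),
                  (∀ x y, 0 ≤ d x y) ∧ (∀ x y, d x y = d y x) ∧ (∀ x y z, d x z ≤ d x y + d y z) ∧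
                  (∀ x, ∑ y, Real.exp (-(μ * d x y)) ≤ C) ∧
                  (∀ b b' : PBond (F.P J) 0, κ * (b.src.tdist b'.src : ℝ) ≤ μ * d (π b) (π b')) ∧
                  (∀ X, 0 ≤ ℓ X) ∧ (∀ X, 0 ≤ h X) ∧
                  (∀ e, ∑ X ∈ Finset.univ.filter (fun X => e ∈ X), ℓ X ≤ A) ∧
                  (∀ e e', ∑ X ∈ Finset.univ.filter (fun X => e ∈ X ∧ e' ∈ X), h X ≤ Hc * Real.exp (-(2 * μ * d e e'))) ∧
                  (∀ (X : Finset (PBond (F.P K) 0)) (U V : GaugeField (F.P J) 0 (Matrix.specialUnitaryGroup (Fin 2) ℂ)),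
                      PlaqSmall (θBal F.L γ b₀ p₀ J) U → PlaqSmall (θBal F.L γ b₀ p₀ J) V →
                      |T X (M U) - T X (M V)| ≤ ℓ X * ∑ e ∈ X, ‖M U e - M V e‖) ∧
                  (∀ (X : Finset (PBond (F.P K) 0)) (U V W Z : GaugeField (F.P J) 0 (Matrix.specialUnitaryGroup (Fin 2) ℂ)),
                      PlaqSmall (θBal F.L γ b₀ p₀ J) U → PlaqSmall (θBal F.L γ b₀ p₀ J) V →
                      PlaqSmall (θBal F.L γ b₀ p₀ J) W → PlaqSmall (θBal F.L γ b₀ p₀ J) Z →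
                      |T X (M U) - T X (M W) - T X (M V) + T X (M Z)| ≤
                        h X * (∑ e ∈ X, ‖M W e - M Z e‖) * (∑ e ∈ X, ‖M V e - M Z e‖) +
                          ℓ X * ∑ e ∈ X, ‖M U e - M W e - M V e + M Z e‖) ∧
                  (∀ (b : PBond (F.P J) 0) (U V : GaugeField (F.P J) 0 (Matrix.specialUnitaryGroup (Fin 2) ℂ)),
                      PlaqSmall (θBal F.L γ b₀ p₀ J) U → PlaqSmall (θBal F.L γ b₀ p₀ J) V → (∀ e, e ≠ b → U e = V e) →
                      ∀ e, ‖M U e - M V e‖ ≤ σ J * Real.exp (-(2 * μ * d (π b) e))) ∧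
                  (∀ (b b' : PBond (F.P J) 0) (U V W Z : GaugeField (F.P J) 0 (Matrix.specialUnitaryGroup (Fin 2) ℂ)),
                      PlaqSmall (θBal F.L γ b₀ p₀ J) U → PlaqSmall (θBal F.L γ b₀ p₀ J) V →
                      PlaqSmall (θBal F.L γ b₀ p₀ J) W → PlaqSmall (θBal F.L γ b₀ p₀ J) Z →
                      (∀ e, e ≠ b → U e = V e) → (∀ e, e ≠ b' → U e = W e) → (∀ e, e ≠ b' → V e = Z e) → (∀ e, e ≠ b → W e = Z e) →
                      ∀ e, ‖M U e - M W e - M V e + M Z e‖ ≤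
                        σ₂ J * (Real.exp (-(2 * μ * d (π b) e)) * Real.exp (-(2 * μ * d e (π b'))))) ∧
                  (∀ U : GaugeField (F.P J) 0 (Matrix.specialUnitaryGroup (Fin 2) ℂ), PlaqSmall (θBal F.L γ b₀ p₀ J) U →
                      Real.log (ρ U) + (F.scheme ℰp γ).β K * minActionRegPr F J K hJK ε₀ U = c₀ + ∑ X, T X (M U)) := by
  intro L
  obtain ⟨pS, HpS⟩ := hA L
  refine ⟨pS, ?_⟩
  intro b₀ p₀ hb₀ hpS hp₀
  obtain ⟨ε₁, hε₁, Hε⟩ := HpS b₀ p₀ hb₀ hpS hp₀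
  refine ⟨ε₁, hε₁, ?_⟩
  intro ε₀ hε₀ hε₀₁
  obtain ⟨γ₁, hγ₁, κ, μ, C, A, Hc, Rₐ, hκ, hμ, hA0, hHc, hRₐ, HF⟩ := Hε ε₀ hε₀ hε₀₁
  refine ⟨γ₁, hγ₁, κ, μ, C, 2 * A / Rₐ, 16 * Hc / Rₐ ^ 2, hκ, hμ, by positivity, by positivity, ?_⟩
  intro F γ hFL hγ hγ₁'
  obtain ⟨σ, σ₂, hσ0, hσ₂0, hσ, hσ₂, Hν⟩ := HF F γ hFL hγ hγ₁'
  refine ⟨σ, σ₂, hσ0, hσ₂0, hσ, hσ₂, ?_⟩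
  intro ν hνK hνd J K hJK ρ hρpos hρν hρcont
  obtain ⟨c₀, π, d, M, 𝒯, Dom, Bx, hd0, hdsym, hdtri, hdsum, hdcmp, hBx0, hpin1, hpin2, hana, hbdd, hcol, hsens1, hsens2, hrep⟩ :=
    Hν ν hνK hνd J K hJK ρ hρpos hρν hρcont
  -- the complexified background-window image and its collar
  set S' : Set (PBond (F.P K) 0 → (Fin 8 → ℂ)) :=
    {w | ∃ U : GaugeField (F.P J) 0 (Matrix.specialUnitaryGroup (Fin 2) ℂ),
      PlaqSmall (θBal F.L γ b₀ p₀ J) U ∧ w = fun e i => (M U e i : ℂ)} with hS'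
  have hcol' : ∀ (X : Finset (PBond (F.P K) 0)), ∀ w ∈ S', Metric.ball (fun e : ↥X => w e) (2 * Rₐ) ⊆ Dom X := by
    rintro X w ⟨U, hU, rfl⟩; exact hcol X U hU
  have memS' : ∀ U : GaugeField (F.P J) 0 (Matrix.specialUnitaryGroup (Fin 2) ℂ), PlaqSmall (θBal F.L γ b₀ p₀ J) U →
      (fun e i => (M U e i : ℂ)) ∈ S' := fun U hU => ⟨U, hU, rfl⟩
  refine ⟨c₀, π, d, M, fun X u => (𝒯 X (fun (e : ↥X) (i : Fin 8) => (u e i : ℂ))).re,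
    fun X => 2 * Bx X / Rₐ, fun X => 16 * Bx X / Rₐ ^ 2, hd0, hdsym, hdtri, hdsum, hdcmp,
    fun X => by have := hBx0 X; positivity, fun X => by have := hBx0 X; positivity, ?_, ?_, ?_, ?_, hsens1, hsens2, ?_⟩
  · -- one-pin sum of `ℓ`
    intro e
    have h := hpin1 e
    calc ∑ X ∈ Finset.univ.filter (fun X => e ∈ X), 2 * Bx X / Rₐ
        = 2 * (∑ X ∈ Finset.univ.filter (fun X => e ∈ X), Bx X) / Rₐ := by
          rw [Finset.mul_sum, Finset.sum_div]
      _ ≤ 2 * A / Rₐ := div_le_div_of_nonneg_right (by linarith) hRₐ.le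
  · -- two-pin sum of `h`
    intro e e'
    have h := hpin2 e e'
    calc ∑ X ∈ Finset.univ.filter (fun X => e ∈ X ∧ e' ∈ X), 16 * Bx X / Rₐ ^ 2
        = 16 * (∑ X ∈ Finset.univ.filter (fun X => e ∈ X ∧ e' ∈ X), Bx X) / Rₐ ^ 2 := by
          rw [Finset.mul_sum, Finset.sum_div]
      _ ≤ 16 * (Hc * Real.exp (-(2 * μ * d e e'))) / Rₐ ^ 2 := div_le_div_of_nonneg_right (by linarith) (by positivity)
      _ = 16 * Hc / Rₐ ^ 2 * Real.exp (-(2 * μ * d e e')) := by ring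
  · -- (lip), for ALL window pairs, by the collar edition
    intro X U V hU hV
    have key := lip_of_local_analytic_collar X (hana X) (hbdd X) hRₐ S' (hcol' X)
      (fun e i => (M U e i : ℂ)) (fun e i => (M V e i : ℂ)) (memS' U hU) (memS' V hV)
    refine key.trans (mul_le_mul_of_nonneg_left (Finset.sum_le_sum fun e _ => pi_norm_ofReal_sub_le (M U e) (M V e)) ?_)
    have := hBx0 X; positivity
  · -- (C11), for ALL window quadruples, by the collar edition (corners `u₀₀ := Z, u₁₀ := W, u₀₁ := V, u₁₁ := U`)
    intro X U V W Z hU hV hW hZ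
    have key := c11_of_local_analytic_collar X (hana X) (hbdd X) hRₐ S' (hcol' X)
      (fun e i => (M Z e i : ℂ)) (fun e i => (M W e i : ℂ)) (fun e i => (M V e i : ℂ)) (fun e i => (M U e i : ℂ))
      (memS' Z hZ) (memS' W hW) (memS' V hV) (memS' U hU)
    refine key.trans ?_
    have hB := hBx0 X
    have h1 : ∑ e ∈ X, ‖(fun i => (M W e i : ℂ)) - (fun i => (M Z e i : ℂ))‖ ≤ ∑ e ∈ X, ‖M W e - M Z e‖ :=
      Finset.sum_le_sum fun e _ => pi_norm_ofReal_sub_le (M W e) (M Z e)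
    have h2 : ∑ e ∈ X, ‖(fun i => (M V e i : ℂ)) - (fun i => (M Z e i : ℂ))‖ ≤ ∑ e ∈ X, ‖M V e - M Z e‖ :=
      Finset.sum_le_sum fun e _ => pi_norm_ofReal_sub_le (M V e) (M Z e)
    have h3 : ∑ e ∈ X, ‖(fun i => (M U e i : ℂ)) - (fun i => (M W e i : ℂ)) - (fun i => (M V e i : ℂ)) + (fun i => (M Z e i : ℂ))‖ ≤
        ∑ e ∈ X, ‖M U e - M W e - M V e + M Z e‖ :=
      Finset.sum_le_sum fun e _ => pi_norm_ofReal_sub_sub_add_le (M U e) (M W e) (M V e) (M Z e)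
    have hs1 : 0 ≤ ∑ e ∈ X, ‖(fun i => (M W e i : ℂ)) - (fun i => (M Z e i : ℂ))‖ := Finset.sum_nonneg fun e _ => norm_nonneg _
    have hs2 : 0 ≤ ∑ e ∈ X, ‖M V e - M Z e‖ := Finset.sum_nonneg fun e _ => norm_nonneg _
    have hc₁ : 0 ≤ 16 * Bx X / Rₐ ^ 2 := by positivity
    have hc₂ : 0 ≤ 2 * Bx X / Rₐ := by positivity
    exact add_le_add
      (mul_le_mul (mul_le_mul_of_nonneg_left h1 hc₁) h2 (Finset.sum_nonneg fun e _ => norm_nonneg _) (mul_nonneg hc₁ (hs1.trans h1)))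
      (mul_le_mul_of_nonneg_left h3 hc₂)
  · -- representation
    intro U hU
    exact hrep U hU

/-! ## §2 BGFORMᵃ∘ → S2β and BGFORMᵃ∘ → GRAD∘ (composition with LEAD w3-20520 g20's ✓`…BackgroundFormKnit`) -/

/-- ★★★ **BGFORMᵃ∘ → S2β.**  Hypothesis = BGFORMᵃ∘ (§1); conclusion = the PATH-B organ S2β `FluctuationPartSmall` (registry `Lines/semiclassical_s2beta.lean` v11.4
:412 VERBATIM, normalised sha16 e30624f0b884478a): `fluctuationPartSmall_of_backgroundForm ∘ backgroundForm_of_analytic`.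
[cite: Balaban1985UV3, Thm 2 p.263 and (41) p.266; Balaban1987RG1, (0.22)-(0.25) pp.256-257 and (1.11)-(1.14) p.262; Balaban1989LargeFieldII, (1.98)-(1.100) p.390; Balaban1985Variational, Prop. 9 p.309] -/
theorem fluctuationPartSmall_of_backgroundFormAnalytic
    (hA :
        ∀ (L : ℕ), ∃ pS : ℝ, ∀ (b₀ p₀ : ℝ), 0 < b₀ → pS ≤ p₀ → 0 < p₀ → ∃ ε₁ : ℝ, 0 < ε₁ ∧ ∀ (ε₀ : ℝ), 0 < ε₀ → ε₀ ≤ ε₁ →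
          ∃ γ₁ : ℝ, 0 < γ₁ ∧ ∃ (κ μ C A Hc Rₐ : ℝ), 0 < κ ∧ 0 ≤ μ ∧ 0 ≤ A ∧ 0 ≤ Hc ∧ 0 < Rₐ ∧ ∀ (F : T3Family) (γ : ℝ), F.L = L → 0 < γ → γ ≤ γ₁ →
            ∃ (σ σ₂ : ℕ → ℝ), (∀ J, 0 ≤ σ J) ∧ (∀ J, 0 ≤ σ₂ J) ∧
              (∀ a : ℕ, Tendsto (fun J : ℕ => ((J : ℝ) + 1) ^ a * σ J) atTop (𝓝 0)) ∧
              (∀ a : ℕ, Tendsto (fun J : ℕ => ((J : ℝ) + 1) ^ a * σ₂ J) atTop (𝓝 0)) ∧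
              ∀ (ν : ℕ → (j : ℕ) → Measure (GaugeField (F.P j) 0 (Matrix.specialUnitaryGroup (Fin 2) ℂ))),
                (∀ K, ν K K = T4GenFunBounds.gibbsMeasure (F.P K) ((F.scheme ℰp γ).β K)) →
                (∀ K j, j < K → ν K j = Measure.map (descend F ℰp j) (ν K (j + 1))) →
                ∀ (J K : ℕ) (hJK : J ≤ K) (ρ : GaugeField (F.P J) 0 (Matrix.specialUnitaryGroup (Fin 2) ℂ) → ℝ),
                  (∀ U, PlaqSmall (θBal F.L γ b₀ p₀ J) U → 0 < ρ U) →
                  ν K J = (fieldMeasure _ _ _).withDensity (fun U => ENNReal.ofReal (ρ U)) →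
                  ContinuousOn ρ {U | PlaqSmall (θBal F.L γ b₀ p₀ J) U} →
                  ∃ (c₀ : ℝ) (π : PBond (F.P J) 0 → PBond (F.P K) 0) (d : PBond (F.P K) 0 → PBond (F.P K) 0 → ℝ)
                    (M : GaugeField (F.P J) 0 (Matrix.specialUnitaryGroup (Fin 2) ℂ) → PBond (F.P K) 0 → (Fin 8 → ℝ))
                    (𝒯 : (X : Finset (PBond (F.P K) 0)) → ((↥X → (Fin 8 → ℂ)) → ℂ))
                    (Dom : (X : Finset (PBond (F.P K) 0)) → Set (↥X → (Fin 8 → ℂ)))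
                    (Bx : Finset (PBond (F.P K) 0) → ℝ),
                    (∀ x y, 0 ≤ d x y) ∧ (∀ x y, d x y = d y x) ∧ (∀ x y z, d x z ≤ d x y + d y z) ∧
                    (∀ x, ∑ y, Real.exp (-(μ * d x y)) ≤ C) ∧
                    (∀ b b' : PBond (F.P J) 0, κ * (b.src.tdist b'.src : ℝ) ≤ μ * d (π b) (π b')) ∧
                    (∀ X, 0 ≤ Bx X) ∧
                    (∀ e, ∑ X ∈ Finset.univ.filter (fun X => e ∈ X), Bx X ≤ A) ∧
                    (∀ e e', ∑ X ∈ Finset.univ.filter (fun X => e ∈ X ∧ e' ∈ X), Bx X ≤ Hc * Real.exp (-(2 * μ * d e e'))) ∧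
                    (∀ X, DifferentiableOn ℂ (𝒯 X) (Dom X)) ∧
                    (∀ X, ∀ p ∈ Dom X, ‖𝒯 X p‖ ≤ Bx X) ∧
                    (∀ (X : Finset (PBond (F.P K) 0)) (U : GaugeField (F.P J) 0 (Matrix.specialUnitaryGroup (Fin 2) ℂ)),
                        PlaqSmall (θBal F.L γ b₀ p₀ J) U →
                        Metric.ball (fun (e : ↥X) (i : Fin 8) => (M U e i : ℂ)) (2 * Rₐ) ⊆ Dom X) ∧
                    (∀ (b : PBond (F.P J) 0) (U V : GaugeField (F.P J) 0 (Matrix.specialUnitaryGroup (Fin 2) ℂ)),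
                        PlaqSmall (θBal F.L γ b₀ p₀ J) U → PlaqSmall (θBal F.L γ b₀ p₀ J) V → (∀ e, e ≠ b → U e = V e) →
                        ∀ e, ‖M U e - M V e‖ ≤ σ J * Real.exp (-(2 * μ * d (π b) e))) ∧
                    (∀ (b b' : PBond (F.P J) 0) (U V W Z : GaugeField (F.P J) 0 (Matrix.specialUnitaryGroup (Fin 2) ℂ)),
                        PlaqSmall (θBal F.L γ b₀ p₀ J) U → PlaqSmall (θBal F.L γ b₀ p₀ J) V →
                        PlaqSmall (θBal F.L γ b₀ p₀ J) W → PlaqSmall (θBal F.L γ b₀ p₀ J) Z →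
                        (∀ e, e ≠ b → U e = V e) → (∀ e, e ≠ b' → U e = W e) → (∀ e, e ≠ b' → V e = Z e) → (∀ e, e ≠ b → W e = Z e) →
                        ∀ e, ‖M U e - M W e - M V e + M Z e‖ ≤
                          σ₂ J * (Real.exp (-(2 * μ * d (π b) e)) * Real.exp (-(2 * μ * d e (π b'))))) ∧
                    (∀ U : GaugeField (F.P J) 0 (Matrix.specialUnitaryGroup (Fin 2) ℂ), PlaqSmall (θBal F.L γ b₀ p₀ J) U →
                        Real.log (ρ U) + (F.scheme ℰp γ).β K * minActionRegPr F J K hJK ε₀ U = c₀ + ∑ X, (𝒯 X (fun (e : ↥X) (i : Fin 8) => (M U e i : ℂ))).re)) :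
      ∀ (L : ℕ), ∃ pS : ℝ, ∀ (b₀ p₀ : ℝ), 0 < b₀ → pS ≤ p₀ → 0 < p₀ → ∃ ε₁ : ℝ, 0 < ε₁ ∧ ∀ (ε₀ : ℝ), 0 < ε₀ → ε₀ ≤ ε₁ →
        ∃ γ₁ : ℝ, 0 < γ₁ ∧ ∃ κ : ℝ, 0 < κ ∧ ∀ (F : T3Family) (γ : ℝ), F.L = L → 0 < γ → γ ≤ γ₁ →
          ∃ (φ : ℕ → ℝ), (∀ J, 0 ≤ φ J) ∧ Tendsto (fun J : ℕ => (J : ℝ) * φ J) atTop (𝓝 0) ∧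
            ∀ (ν : ℕ → (j : ℕ) → Measure (GaugeField (F.P j) 0 (Matrix.specialUnitaryGroup (Fin 2) ℂ))),
              (∀ K, ν K K = T4GenFunBounds.gibbsMeasure (F.P K) ((F.scheme ℰp γ).β K)) →
              (∀ K j, j < K → ν K j = Measure.map (descend F ℰp j) (ν K (j + 1))) →
              ∀ (J K : ℕ) (hJK : J ≤ K) (ρ : GaugeField (F.P J) 0 (Matrix.specialUnitaryGroup (Fin 2) ℂ) → ℝ),
                (∀ U, PlaqSmall (θBal F.L γ b₀ p₀ J) U → 0 < ρ U) →
                ν K J = (fieldMeasure _ _ _).withDensity (fun U => ENNReal.ofReal (ρ U)) →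
                ContinuousOn ρ {U | PlaqSmall (θBal F.L γ b₀ p₀ J) U} →
                ∀ (b b' : PBond (F.P J) 0) (U V W Z : GaugeField (F.P J) 0 (Matrix.specialUnitaryGroup (Fin 2) ℂ)),
                  PlaqSmall (θBal F.L γ b₀ p₀ J) U → PlaqSmall (θBal F.L γ b₀ p₀ J) V →
                  PlaqSmall (θBal F.L γ b₀ p₀ J) W → PlaqSmall (θBal F.L γ b₀ p₀ J) Z →
                  (∀ e, e ≠ b → U e = V e) → (∀ e, e ≠ b' → U e = W e) → (∀ e, e ≠ b' → V e = Z e) → (∀ e, e ≠ b → W e = Z e) →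
                  |((Real.log (ρ U) + (F.scheme ℰp γ).β K * minActionRegPr F J K hJK ε₀ U)
                      - (Real.log (ρ V) + (F.scheme ℰp γ).β K * minActionRegPr F J K hJK ε₀ V))
                    - ((Real.log (ρ W) + (F.scheme ℰp γ).β K * minActionRegPr F J K hJK ε₀ W)
                      - (Real.log (ρ Z) + (F.scheme ℰp γ).β K * minActionRegPr F J K hJK ε₀ Z))|
                    ≤ φ J * Real.exp (-(κ * (b.src.tdist b'.src : ℝ))) :=
  fluctuationPartSmall_of_backgroundForm (backgroundForm_of_analytic hA)

/-- ★★★ **BGFORMᵃ∘ → GRAD∘.**  Hypothesis = BGFORMᵃ∘ (§1); conclusion = GRAD∘ `OneBondOscillationCan` (LINE g24-1 `Lines/gradient_split.lean` §0 VERBATIM):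
`oneBondOscillation_of_backgroundForm ∘ backgroundForm_of_analytic`.
[cite: Balaban1987RG1, Thm 1 (0.24)-(0.25) p.257 and (1.11)-(1.14) p.262; Balaban1989LargeFieldII, (1.98)-(1.100) p.390; Balaban1985Variational, Prop. 9 p.309] -/
theorem oneBondOscillation_of_backgroundFormAnalytic
    (hA :
        ∀ (L : ℕ), ∃ pS : ℝ, ∀ (b₀ p₀ : ℝ), 0 < b₀ → pS ≤ p₀ → 0 < p₀ → ∃ ε₁ : ℝ, 0 < ε₁ ∧ ∀ (ε₀ : ℝ), 0 < ε₀ → ε₀ ≤ ε₁ →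
          ∃ γ₁ : ℝ, 0 < γ₁ ∧ ∃ (κ μ C A Hc Rₐ : ℝ), 0 < κ ∧ 0 ≤ μ ∧ 0 ≤ A ∧ 0 ≤ Hc ∧ 0 < Rₐ ∧ ∀ (F : T3Family) (γ : ℝ), F.L = L → 0 < γ → γ ≤ γ₁ →
            ∃ (σ σ₂ : ℕ → ℝ), (∀ J, 0 ≤ σ J) ∧ (∀ J, 0 ≤ σ₂ J) ∧
              (∀ a : ℕ, Tendsto (fun J : ℕ => ((J : ℝ) + 1) ^ a * σ J) atTop (𝓝 0)) ∧
              (∀ a : ℕ, Tendsto (fun J : ℕ => ((J : ℝ) + 1) ^ a * σ₂ J) atTop (𝓝 0)) ∧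
              ∀ (ν : ℕ → (j : ℕ) → Measure (GaugeField (F.P j) 0 (Matrix.specialUnitaryGroup (Fin 2) ℂ))),
                (∀ K, ν K K = T4GenFunBounds.gibbsMeasure (F.P K) ((F.scheme ℰp γ).β K)) →
                (∀ K j, j < K → ν K j = Measure.map (descend F ℰp j) (ν K (j + 1))) →
                ∀ (J K : ℕ) (hJK : J ≤ K) (ρ : GaugeField (F.P J) 0 (Matrix.specialUnitaryGroup (Fin 2) ℂ) → ℝ),
                  (∀ U, PlaqSmall (θBal F.L γ b₀ p₀ J) U → 0 < ρ U) →
                  ν K J = (fieldMeasure _ _ _).withDensity (fun U => ENNReal.ofReal (ρ U)) →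
                  ContinuousOn ρ {U | PlaqSmall (θBal F.L γ b₀ p₀ J) U} →
                  ∃ (c₀ : ℝ) (π : PBond (F.P J) 0 → PBond (F.P K) 0) (d : PBond (F.P K) 0 → PBond (F.P K) 0 → ℝ)
                    (M : GaugeField (F.P J) 0 (Matrix.specialUnitaryGroup (Fin 2) ℂ) → PBond (F.P K) 0 → (Fin 8 → ℝ))
                    (𝒯 : (X : Finset (PBond (F.P K) 0)) → ((↥X → (Fin 8 → ℂ)) → ℂ))
                    (Dom : (X : Finset (PBond (F.P K) 0)) → Set (↥X → (Fin 8 → ℂ)))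
                    (Bx : Finset (PBond (F.P K) 0) → ℝ),
                    (∀ x y, 0 ≤ d x y) ∧ (∀ x y, d x y = d y x) ∧ (∀ x y z, d x z ≤ d x y + d y z) ∧
                    (∀ x, ∑ y, Real.exp (-(μ * d x y)) ≤ C) ∧
                    (∀ b b' : PBond (F.P J) 0, κ * (b.src.tdist b'.src : ℝ) ≤ μ * d (π b) (π b')) ∧
                    (∀ X, 0 ≤ Bx X) ∧
                    (∀ e, ∑ X ∈ Finset.univ.filter (fun X => e ∈ X), Bx X ≤ A) ∧
                    (∀ e e', ∑ X ∈ Finset.univ.filter (fun X => e ∈ X ∧ e' ∈ X), Bx X ≤ Hc * Real.exp (-(2 * μ * d e e'))) ∧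
                    (∀ X, DifferentiableOn ℂ (𝒯 X) (Dom X)) ∧
                    (∀ X, ∀ p ∈ Dom X, ‖𝒯 X p‖ ≤ Bx X) ∧
                    (∀ (X : Finset (PBond (F.P K) 0)) (U : GaugeField (F.P J) 0 (Matrix.specialUnitaryGroup (Fin 2) ℂ)),
                        PlaqSmall (θBal F.L γ b₀ p₀ J) U →
                        Metric.ball (fun (e : ↥X) (i : Fin 8) => (M U e i : ℂ)) (2 * Rₐ) ⊆ Dom X) ∧
                    (∀ (b : PBond (F.P J) 0) (U V : GaugeField (F.P J) 0 (Matrix.specialUnitaryGroup (Fin 2) ℂ)),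
                        PlaqSmall (θBal F.L γ b₀ p₀ J) U → PlaqSmall (θBal F.L γ b₀ p₀ J) V → (∀ e, e ≠ b → U e = V e) →
                        ∀ e, ‖M U e - M V e‖ ≤ σ J * Real.exp (-(2 * μ * d (π b) e))) ∧
                    (∀ (b b' : PBond (F.P J) 0) (U V W Z : GaugeField (F.P J) 0 (Matrix.specialUnitaryGroup (Fin 2) ℂ)),
                        PlaqSmall (θBal F.L γ b₀ p₀ J) U → PlaqSmall (θBal F.L γ b₀ p₀ J) V →
                        PlaqSmall (θBal F.L γ b₀ p₀ J) W → PlaqSmall (θBal F.L γ b₀ p₀ J) Z →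
                        (∀ e, e ≠ b → U e = V e) → (∀ e, e ≠ b' → U e = W e) → (∀ e, e ≠ b' → V e = Z e) → (∀ e, e ≠ b → W e = Z e) →
                        ∀ e, ‖M U e - M W e - M V e + M Z e‖ ≤
                          σ₂ J * (Real.exp (-(2 * μ * d (π b) e)) * Real.exp (-(2 * μ * d e (π b'))))) ∧
                    (∀ U : GaugeField (F.P J) 0 (Matrix.specialUnitaryGroup (Fin 2) ℂ), PlaqSmall (θBal F.L γ b₀ p₀ J) U →
                        Real.log (ρ U) + (F.scheme ℰp γ).β K * minActionRegPr F J K hJK ε₀ U = c₀ + ∑ X, (𝒯 X (fun (e : ↥X) (i : Fin 8) => (M U e i : ℂ))).re)) :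
      ∀ (L : ℕ), ∃ pS : ℝ, ∀ (b₀ p₀ : ℝ), 0 < b₀ → pS ≤ p₀ → 0 < p₀ → ∃ ε₁ : ℝ, 0 < ε₁ ∧ ∀ (ε₀ : ℝ), 0 < ε₀ → ε₀ ≤ ε₁ →
        ∃ γ₁ : ℝ, 0 < γ₁ ∧ ∀ (F : T3Family) (γ : ℝ), F.L = L → 0 < γ → γ ≤ γ₁ →
          ∃ (σ : ℕ → ℝ), (∀ J, 0 ≤ σ J) ∧ (∀ a : ℕ, Tendsto (fun J : ℕ => ((J : ℝ) + 1) ^ a * σ J) atTop (𝓝 0)) ∧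
            ∀ (ν : ℕ → (j : ℕ) → Measure (GaugeField (F.P j) 0 (Matrix.specialUnitaryGroup (Fin 2) ℂ))),
              (∀ K, ν K K = T4GenFunBounds.gibbsMeasure (F.P K) ((F.scheme ℰp γ).β K)) →
              (∀ K j, j < K → ν K j = Measure.map (descend F ℰp j) (ν K (j + 1))) →
              ∀ (J K : ℕ) (hJK : J ≤ K) (ρ : GaugeField (F.P J) 0 (Matrix.specialUnitaryGroup (Fin 2) ℂ) → ℝ),
                (∀ U, PlaqSmall (θBal F.L γ b₀ p₀ J) U → 0 < ρ U) →
                ν K J = (fieldMeasure _ _ _).withDensity (fun U => ENNReal.ofReal (ρ U)) →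
                ContinuousOn ρ {U | PlaqSmall (θBal F.L γ b₀ p₀ J) U} →
                ∀ (b : PBond (F.P J) 0) (U V : GaugeField (F.P J) 0 (Matrix.specialUnitaryGroup (Fin 2) ℂ)),
                  PlaqSmall (θBal F.L γ b₀ p₀ J) U → PlaqSmall (θBal F.L γ b₀ p₀ J) V →
                  (∀ e, e ≠ b → U e = V e) →
                  |(Real.log (ρ U) + (F.scheme ℰp γ).β K * minActionRegPr F J K hJK ε₀ U)
                      - (Real.log (ρ V) + (F.scheme ℰp γ).β K * minActionRegPr F J K hJK ε₀ V)| ≤ σ J :=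
  oneBondOscillation_of_backgroundForm (backgroundForm_of_analytic hA)

end Summit.QuantumFields.YangMills.Theorems.FluctuationComparisonRegPrIntLBackgroundFormAnalyticKnit
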